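import Literature.Probability.LatticeModels.VillainSpinWaveProofs
import Literature.Probability.LatticeModels.VillainPinnedMonotonicity
import Literature.Probability.LatticeModels.VillainKernelConcentration
import HarnessLib

/-!
# The thermodynamic limit of the Villain two-point function with zero boundary condition:
# `⟨S_0·S_x⟩_{□_n,β,0}` is non-increasing in the cube and converges

Proof file for the first clause (existence of the thermodynamic limit) of the named fact
`Literature.Probability.LatticeModels.FrohlichSpencerVillainSpinWaveBound` (`VillainSpinWave.lean`;
Dario–Wu 2020 Prop. 1.1 after Fröhlich–Spencer 1982: "the thermodynamic limit of the measures (1.1)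
exists as `□ → ℤ^d` … a consequence of correlation inequalities [Gi, BFL, MMP]"), assembled from
the tree's Ginibre monotonicity for pinned Villain models (`VillainPinnedMonotonicity.lean`) and the
pinning limit `K → ∞` (`VillainKernelConcentration.lean`):

* `toOpt`, `prod_villainKernel_toOpt_eq_weight` — the zero-boundary-condition model of the cube
  `□ = box d (n+1)` IS a pinned Villain model (end-points `toOpt y ∈ Option (box d n)`, `none` = the
  grounded shell);
* `bdryEdges`, `freeEnd`, `pinMult`, `prod_villainKernel_raised_eq`, `one_le_pinMult` — raising the
  stiffness to `K` on the boundary edges multiplies the non-boundary weight by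
  `∏_{u ∈ outer layer} v_K(θ_u)^{pinMult u}` with `pinMult u ≥ 1` (`d ≥ 1`);
* `layerEquiv`, `toOpt_elim_symm_zero`, `prod_compl_bdryEdges_symm_zero`,
  `setIntegral_angleCube_comp_layerEquiv` — with the outer layer set to `0` the non-boundary weight
  of `box d (n+2)` is `v_β(0)^{#outer} ·` the weight of the cube `box d (n+1)`, and integrals over the
  inner block are integrals over `[-π,π)^{box d n}` (volume-preserving re-indexing);
* **`dirichletVillainTwoPoint_succ_le`** — `⟨S_0·S_x⟩_{□_{n+1},β,0} ≤ ⟨S_0·S_x⟩_{□_n,β,0}` for all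
  `d ≥ 1`, `β > 0`, `x` (Ginibre: raising the boundary stiffness from `β` to `K` increases the
  two-point function; `K → ∞` yields the smaller cube);
* **`tendsto_dirichletVillainTwoPoint_ciInf`** — the limit exists (antitone, `≥ -1`), and
  `exists_tendsto_dirichletVillainTwoPoint_le_exp` — for `d ≥ 3` the limit obeys the spin-wave
  upper bound of `VillainSpinWaveProofs.lean` and `|G| ≤ 1`: clauses (i) and (iii) of the
  transcription of Prop. 1.1. Clauses (ii) (clustering) and (iv) (the lower bound with `o(1/β)`),
  Fröhlich–Spencer's renormalisation-group analysis, are NOT in the tree; the fact stays a fact.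

Everything here is PROVED; no named fact is introduced (the `def`s are data: end-point maps, edge
sets, multiplicities, a re-indexing equivalence).

## References

* [DarioWu2020] P. Dario, W. Wu, arXiv:2002.02946, Ch. 1 §1 (PDF p. 4), Proposition 1.1 (pp. 4–5).
* [Ginibre1970] J. Ginibre, Comm. Math. Phys. 16 (1970) 310–328.
* [AizenmanHarelPeledShapiro2021] M. Aizenman, M. Harel, R. Peled, J. Shapiro, arXiv:2110.09498,
  Cor. 11.4 ("monotone … in the volume of the system. Consequently, the infinite-volume limit of the
  two-point function exists").
* [FrohlichSpencerCMP1982] J. Fröhlich, T. Spencer, Comm. Math. Phys. 83 (1982) 411–454.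
-/

noncomputable section

open MeasureTheory Measure Finset Function Set Filter
open scoped Topology
open Literature.MathematicalPhysics.QuantumFieldTheory

namespace Literature.Probability.LatticeModels

namespace DirichletVillain

variable {d : ℕ} {n : ℕ}

/-! ### The zero-boundary-condition model as a pinned Villain model -/

variable (n) in
/-- A lattice site as an optional interior vertex of the cube `box d (n+1)`: `some ⟨y, _⟩` if
`y ∈ box d n` (a free angle), `none` otherwise (the grounded boundary, angle `0`). [folklore] -/
def toOpt (y : Site d) : Option (SIdx d n) :=
  if h : y ∈ box d n then some ⟨y, h⟩ else none

/-- The pinned angle of a site is its zero-extended angle: `(toOpt y).elim 0 θ = θ̄(y)`. [folklore] -/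
theorem toOpt_elim (θ : SIdx d n → ℝ) (y : Site d) :
    (toOpt n y).elim (0 : ℝ) θ = dirichletExtend n θ y := by
  unfold toOpt
  by_cases h : y ∈ box d n
  · rw [dif_pos h, dirichletExtend_of_mem θ h]; rfl
  · rw [dif_neg h, dirichletExtend_of_not_mem θ h]; rfl

/-- `toOpt y = some a` iff `y = a`. [folklore] -/
theorem toOpt_eq_some_iff {y : Site d} {a : SIdx d n} : toOpt n y = some a ↔ y = (a : Site d) := by
  unfold toOpt
  constructor
  · intro h
    by_cases hy : y ∈ box d n
    · rw [dif_pos hy, Option.some_inj] at h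
      rw [← h]
    · rw [dif_neg hy] at h
      exact absurd h (by simp)
  · rintro rfl
    rw [dif_pos a.2]

/-- `toOpt y = none` iff `y ∉ box d n`. [folklore] -/
theorem toOpt_eq_none_iff {y : Site d} : toOpt n y = none ↔ y ∉ box d n := by
  unfold toOpt
  by_cases hy : y ∈ box d n
  · rw [dif_pos hy]; simp [hy]
  · rw [dif_neg hy]; simp [hy]

/-- **The zero-boundary-condition Villain weight is a pinned Villain weight**: with end-points
`s e = toOpt (x_e)`, `t e = toOpt (x_e + eᵢ)` and constant stiffness `β`,
`∏_e v_β(θ̄(t e) − θ̄(s e)) = dirichletVillainWeight β n θ`. [folklore] -/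
theorem prod_villainKernel_toOpt_eq_weight (β : ℝ) (θ : SIdx d n → ℝ) :
    ∏ e : EIdx d n, villainKernel β
        ((toOpt n (e.1.1 + Pi.single e.1.2 1)).elim (0 : ℝ) θ - (toOpt n e.1.1).elim 0 θ) =
      dirichletVillainWeight β n θ := by
  rw [dirichletVillainWeight_eq_prod]
  refine Finset.prod_congr rfl fun e _ => ?_
  rw [toOpt_elim, toOpt_elim, gradR_apply]

/-- The two-point observable in pinned form. [folklore] -/
theorem cos_toOpt_elim (θ : SIdx d n → ℝ) (x : Site d) :
    Real.cos ((toOpt n 0).elim (0 : ℝ) θ - (toOpt n x).elim 0 θ) =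
      Real.cos (dirichletExtend n θ 0 - dirichletExtend n θ x) := by
  rw [toOpt_elim, toOpt_elim]

/-! ### The boundary edges of the cube, their free end-points and multiplicities -/

variable (n) in
/-- The **boundary edges** of the cube `box d (n+1)`: those with exactly one end-point in the
interior `box d n` (the other one on the grounded shell). Raising their stiffness pins the outer
layer `box d n ∖ box d (n-1)` of the interior to the boundary angle `0`. [folklore] -/
def bdryEdges : Finset (EIdx d n) :=
  Finset.univ.filter fun e =>
    (e.1.1 ∈ box d n ∧ e.1.1 + Pi.single e.1.2 1 ∉ box d n) ∨
      (e.1.1 ∉ box d n ∧ e.1.1 + Pi.single e.1.2 1 ∈ box d n)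

/-- Membership in `bdryEdges`. [folklore] -/
theorem mem_bdryEdges {e : EIdx d n} :
    e ∈ bdryEdges n ↔ (e.1.1 ∈ box d n ∧ e.1.1 + Pi.single e.1.2 1 ∉ box d n) ∨
      (e.1.1 ∉ box d n ∧ e.1.1 + Pi.single e.1.2 1 ∈ box d n) := by
  simp only [bdryEdges, Finset.mem_filter, Finset.mem_univ, true_and]

variable (n) in
/-- The **free end-point** of an edge of the cube: its tail if interior, else its head if interior,
else (both end-points grounded) the junk value `0`. [folklore] -/
def freeEnd (e : EIdx d n) : SIdx d n :=
  if h : e.1.1 ∈ box d n then ⟨e.1.1, h⟩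
  else if h' : e.1.1 + Pi.single e.1.2 1 ∈ box d n then ⟨e.1.1 + Pi.single e.1.2 1, h'⟩
  else ⟨0, zero_mem_box d n⟩

variable (n) in
/-- The **multiplicity** of an interior vertex: the number of boundary edges at it (`= #{i :
|u_i| = n}`; positive exactly on the outer layer of the interior). [folklore] -/
def pinMult (u : SIdx d n) : ℕ :=
  #((bdryEdges n).filter fun e => freeEnd n e = u)

/-- On a boundary edge the pinned difference is `± θ(free end-point)`, so its Villain factor is
`v_K(θ(freeEnd e))` (`v_K` is even). [folklore] -/
theorem villainKernel_bdryEdge (K : ℝ) (θ : SIdx d n → ℝ) {e : EIdx d n} (he : e ∈ bdryEdges n) :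
    villainKernel K ((toOpt n (e.1.1 + Pi.single e.1.2 1)).elim (0 : ℝ) θ - (toOpt n e.1.1).elim 0 θ) =
      villainKernel K (θ (freeEnd n e)) := by
  rcases mem_bdryEdges.1 he with ⟨h1, h2⟩ | ⟨h1, h2⟩
  · rw [toOpt_elim, toOpt_elim, dirichletExtend_of_not_mem θ h2, dirichletExtend_of_mem θ h1, zero_sub,
      villainKernel_neg, freeEnd, dif_pos h1]
  · rw [toOpt_elim, toOpt_elim, dirichletExtend_of_mem θ h2, dirichletExtend_of_not_mem θ h1, sub_zero,
      freeEnd, dif_neg h1, dif_pos h2]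

/-- The free end-point of a boundary edge lies in the outer layer `box d n ∖ box d (n-1)` of the
interior: it has a neighbour off `box d n`. Stated for the cube `box d (n+2)` with interior
`box d (n+1)`: `freeEnd e ∉ box d n`. [folklore] -/
theorem freeEnd_not_mem_box {e : EIdx d (n + 1)} (he : e ∈ bdryEdges (n + 1)) :
    ((freeEnd (n + 1) e : SIdx d (n + 1)) : Site d) ∉ box d n := by
  rcases mem_bdryEdges.1 he with ⟨h1, h2⟩ | ⟨h1, h2⟩
  · rw [freeEnd, dif_pos h1]
    intro h0
    exact h2 (coe_add_single_mem_box_succ ⟨e.1.1, h0⟩ e.1.2 1 (Or.inl rfl))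
  · rw [freeEnd, dif_neg h1, dif_pos h2]
    intro h0
    apply h1
    have h := coe_add_single_mem_box_succ ⟨e.1.1 + Pi.single e.1.2 1, h0⟩ e.1.2 (-1) (Or.inr rfl)
    simp only at h
    rwa [add_assoc, ← Pi.single_add, add_neg_cancel, Pi.single_zero, add_zero] at h

/-- **The pinned weight with raised boundary stiffness factorises**: for stiffness `K` on the
boundary edges and `β` elsewhere,
`∏_e v_{κ_e}(θ̄(t e) − θ̄(s e)) = (∏_{e ∉ bdry} v_β(…)) · ∏_{u ∉ box d n} v_K(θ_u)^{pinMult u}`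
(grouping the boundary edges by their free end-points; cube `box d (n+2)`, interior `box d (n+1)`).
[folklore] -/
theorem prod_villainKernel_raised_eq (β K : ℝ) (θ : SIdx d (n + 1) → ℝ) :
    ∏ e : EIdx d (n + 1), villainKernel (if e ∈ bdryEdges (n + 1) then K else β)
        ((toOpt (n + 1) (e.1.1 + Pi.single e.1.2 1)).elim (0 : ℝ) θ - (toOpt (n + 1) e.1.1).elim 0 θ) =
      (∏ e ∈ (bdryEdges (n + 1))ᶜ, villainKernel β
          ((toOpt (n + 1) (e.1.1 + Pi.single e.1.2 1)).elim (0 : ℝ) θ - (toOpt (n + 1) e.1.1).elim 0 θ)) *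
        ∏ u : {a : SIdx d (n + 1) // (a : Site d) ∉ box d n}, villainKernel K (θ u) ^ pinMult (n + 1) u.1 := by
  rw [← Finset.prod_mul_prod_compl (bdryEdges (n + 1)), mul_comm]
  congr 1
  · refine Finset.prod_congr rfl fun e he => ?_
    rw [if_neg (Finset.mem_compl.1 he)]
  · -- the boundary edges, grouped by their free end-points
    have h1 : ∏ e ∈ bdryEdges (n + 1), villainKernel (if e ∈ bdryEdges (n + 1) then K else β)
        ((toOpt (n + 1) (e.1.1 + Pi.single e.1.2 1)).elim (0 : ℝ) θ - (toOpt (n + 1) e.1.1).elim 0 θ) =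
        ∏ e ∈ bdryEdges (n + 1), villainKernel K (θ (freeEnd (n + 1) e)) :=
      Finset.prod_congr rfl fun e he => by rw [if_pos he, villainKernel_bdryEdge K θ he]
    rw [h1, ← Finset.prod_fiberwise_of_maps_to' (t := Finset.univ.filter fun a : SIdx d (n + 1) =>
      (a : Site d) ∉ box d n) (g := freeEnd (n + 1))
      (fun e he => Finset.mem_filter.2 ⟨Finset.mem_univ _, freeEnd_not_mem_box he⟩)
      (fun u => villainKernel K (θ u))]
    rw [Finset.prod_subtype (Finset.univ.filter fun a : SIdx d (n + 1) => (a : Site d) ∉ box d n)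
      (p := fun a : SIdx d (n + 1) => (a : Site d) ∉ box d n) (fun a => by simp)]
    refine Finset.prod_congr rfl fun u _ => ?_
    rw [Finset.prod_const, pinMult]

/-- **Every vertex of the outer layer carries a boundary edge** (`d ≥ 1`): if `u ∈ box d (n+1)`,
`u ∉ box d n`, then `|u_i| = n + 1` for some `i` and the edge through `u` in the direction
`sign(u_i) eᵢ` leaves `box d (n+1)`; hence `pinMult u ≥ 1`. [folklore] -/
theorem one_le_pinMult {u : SIdx d (n + 1)} (hu : (u : Site d) ∉ box d n) : 1 ≤ pinMult (n + 1) u := by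
  rw [pinMult, Nat.one_le_iff_ne_zero, ne_eq, Finset.card_eq_zero, Finset.filter_eq_empty_iff]
  push Not
  -- a coordinate with `|u_i| = n + 1`
  have hub := mem_box.1 u.2
  obtain ⟨i, hi⟩ : ∃ i, (u : Site d) i = (n : ℤ) + 1 ∨ (u : Site d) i = -((n : ℤ) + 1) := by
    by_contra h
    push Not at h
    apply hu
    rw [mem_box]
    intro j
    have h1 := hub j
    have h2 := h j
    push_cast at h1
    constructor <;> omega
  rcases hi with hi | hi
  · -- the edge `(u, i)` leaves through the face `x_i = n + 2`
    have hmem : ((u : Site d), i) ∈ cubeEdges d (n + 1) := by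
      refine mem_cubeEdges.2 ⟨coe_mem_box_succ u, ?_⟩
      exact coe_add_single_mem_box_succ u i 1 (Or.inl rfl)
    have hout : (u : Site d) + Pi.single i 1 ∉ box d (n + 1) := by
      intro h
      have := (mem_box.1 h i).2
      simp only [Pi.add_apply, Pi.single_eq_same] at this
      push_cast at this
      omega
    refine ⟨⟨((u : Site d), i), hmem⟩, mem_bdryEdges.2 (Or.inl ⟨u.2, hout⟩), ?_⟩
    rw [freeEnd, dif_pos u.2]
  · -- the edge `(u - e_i, i)` enters through the face `x_i = -(n + 2)`
    have hy : (u : Site d) - Pi.single i 1 ∈ box d (n + 1 + 1) := by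
      rw [sub_eq_add_neg, ← Pi.single_neg]
      exact coe_add_single_mem_box_succ u i (-1) (Or.inr rfl)
    have hback : (u : Site d) - Pi.single i 1 + Pi.single i 1 = (u : Site d) := sub_add_cancel _ _
    have hmem : ((u : Site d) - Pi.single i 1, i) ∈ cubeEdges d (n + 1) := by
      refine mem_cubeEdges.2 ⟨hy, ?_⟩
      simp only [hback]
      exact coe_mem_box_succ u
    have hout : (u : Site d) - Pi.single i 1 ∉ box d (n + 1) := by
      intro h
      have := (mem_box.1 h i).1
      simp only [Pi.sub_apply, Pi.single_eq_same] at this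
      push_cast at this
      omega
    have hin : (u : Site d) - Pi.single i 1 + Pi.single i 1 ∈ box d (n + 1) := by rw [hback]; exact u.2
    refine ⟨⟨((u : Site d) - Pi.single i 1, i), hmem⟩, mem_bdryEdges.2 (Or.inr ⟨hout, hin⟩), ?_⟩
    rw [freeEnd, dif_neg hout, dif_pos hin]
    exact Subtype.ext hback


/-! ### The pinned configuration: the outer layer set to `0` is the smaller cube's model -/

variable (n) in
/-- The interior of the smaller cube as the inner block of the larger one:
`box d n ≃ {a ∈ box d (n+1) : a ∈ box d n}`. [folklore] -/
def layerEquiv : SIdx d n ≃ {a : SIdx d (n + 1) // ¬((a : Site d) ∉ box d n)} where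
  toFun y := ⟨⟨(y : Site d), box_mono d (Nat.le_succ n) y.2⟩, not_not.2 y.2⟩
  invFun a := ⟨((a : SIdx d (n + 1)) : Site d), not_not.1 a.2⟩
  left_inv _ := Subtype.ext rfl
  right_inv _ := Subtype.ext (Subtype.ext rfl)

/-- **Pinning the outer layer to `0` yields the zero extension of the smaller cube**: for angles
`a` on the inner block `box d n` of `box d (n+1)`, extended by `0` to the outer layer (`ā`, the
inverse splitting map at `(0, a)`), the pinned angle at every lattice site is the zero extension of
the re-indexed configuration `a ∘ layerEquiv` of the cube `box d n`. [folklore] -/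
theorem toOpt_elim_symm_zero (a : {v : SIdx d (n + 1) // ¬((v : Site d) ∉ box d n)} → ℝ) (y : Site d) :
    (toOpt (n + 1) y).elim (0 : ℝ)
        ((MeasurableEquiv.piEquivPiSubtypeProd (fun _ : SIdx d (n + 1) => ℝ)
          (fun a : SIdx d (n + 1) => (a : Site d) ∉ box d n)).symm (0, a)) =
      dirichletExtend n (fun y' => a (layerEquiv n y')) y := by
  by_cases hy1 : y ∈ box d (n + 1)
  · rw [toOpt_elim, dirichletExtend_of_mem _ hy1]
    show (Equiv.piEquivPiSubtypeProd (fun a : SIdx d (n + 1) => (a : Site d) ∉ box d n)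
      (fun _ : SIdx d (n + 1) => ℝ)).symm (0, a) ⟨y, hy1⟩ = _
    rw [Equiv.piEquivPiSubtypeProd_symm_apply]
    by_cases hy0 : y ∈ box d n
    · rw [dif_neg (not_not.2 hy0 : ¬((⟨y, hy1⟩ : SIdx d (n + 1)) : Site d) ∉ box d n),
        dirichletExtend_of_mem _ hy0]
      rfl
    · rw [dif_pos (hy0 : ((⟨y, hy1⟩ : SIdx d (n + 1)) : Site d) ∉ box d n), dirichletExtend_of_not_mem _ hy0]
      rfl
  · rw [toOpt_elim, dirichletExtend_of_not_mem _ hy1, dirichletExtend_of_not_mem]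
    exact fun h => hy1 (box_mono d (Nat.le_succ n) h)

/-- The inner edges of the cube `box d (n+2)` (both end-points in `box d (n+1)`) are the edges of the
cube `box d (n+1)`: a product over them is a product over `EIdx d n`. [folklore] -/
theorem prod_filter_inner_eq (f : Site d × Fin d → ℝ) :
    ∏ e ∈ (Finset.univ : Finset (EIdx d (n + 1))).filter
        (fun e => e.1.1 ∈ box d (n + 1) ∧ e.1.1 + Pi.single e.1.2 1 ∈ box d (n + 1)), f e.1 =
      ∏ e : EIdx d n, f e.1 := by
  refine Finset.prod_bij' (fun e he => (⟨e.1, mem_cubeEdges.2 (Finset.mem_filter.1 he).2⟩ : EIdx d n))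
    (fun e _ => (⟨e.1, mem_cubeEdges.2 ⟨box_mono d (Nat.le_succ _) (mem_cubeEdges.1 e.2).1,
      box_mono d (Nat.le_succ _) (mem_cubeEdges.1 e.2).2⟩⟩ : EIdx d (n + 1)))
    (fun e he => Finset.mem_univ _)
    (fun e he => Finset.mem_filter.2 ⟨Finset.mem_univ _, mem_cubeEdges.1 e.2⟩)
    (fun e he => Subtype.ext rfl) (fun e he => Subtype.ext rfl) (fun e he => rfl)

/-- **The complementary (non-boundary) weight at the pinned configuration is the smaller cube's
weight** up to the constant factors of the grounded–grounded edges: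
`∏_{e ∉ bdry} v_β(θ̄(t e) − θ̄(s e))|_{θ = ā} = v_β(0)^{#outer} · w_β^{(n)}(a ∘ layerEquiv)`. [folklore] -/
theorem prod_compl_bdryEdges_symm_zero (β : ℝ) (a : {v : SIdx d (n + 1) // ¬((v : Site d) ∉ box d n)} → ℝ) :
    ∏ e ∈ (bdryEdges (n + 1))ᶜ, villainKernel β
        ((toOpt (n + 1) (e.1.1 + Pi.single e.1.2 1)).elim (0 : ℝ)
            ((MeasurableEquiv.piEquivPiSubtypeProd (fun _ : SIdx d (n + 1) => ℝ)
              (fun a : SIdx d (n + 1) => (a : Site d) ∉ box d n)).symm (0, a)) -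
          (toOpt (n + 1) e.1.1).elim 0
            ((MeasurableEquiv.piEquivPiSubtypeProd (fun _ : SIdx d (n + 1) => ℝ)
              (fun a : SIdx d (n + 1) => (a : Site d) ∉ box d n)).symm (0, a))) =
      villainKernel β 0 ^ #((Finset.univ : Finset (EIdx d (n + 1))).filter
          (fun e => e.1.1 ∉ box d (n + 1) ∧ e.1.1 + Pi.single e.1.2 1 ∉ box d (n + 1))) *
        dirichletVillainWeight β n (fun y' => a (layerEquiv n y')) := by
  simp_rw [toOpt_elim_symm_zero]
  -- split the complement into outer and inner edges
  have hcompl : (bdryEdges (n + 1))ᶜ =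
      (Finset.univ : Finset (EIdx d (n + 1))).filter
          (fun e => e.1.1 ∉ box d (n + 1) ∧ e.1.1 + Pi.single e.1.2 1 ∉ box d (n + 1)) ∪
        (Finset.univ : Finset (EIdx d (n + 1))).filter
          (fun e => e.1.1 ∈ box d (n + 1) ∧ e.1.1 + Pi.single e.1.2 1 ∈ box d (n + 1)) := by
    ext e
    simp only [Finset.mem_compl, mem_bdryEdges, Finset.mem_union, Finset.mem_filter, Finset.mem_univ,
      true_and]
    tauto
  have hdisj : Disjoint
      ((Finset.univ : Finset (EIdx d (n + 1))).filter
        (fun e => e.1.1 ∉ box d (n + 1) ∧ e.1.1 + Pi.single e.1.2 1 ∉ box d (n + 1)))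
      ((Finset.univ : Finset (EIdx d (n + 1))).filter
        (fun e => e.1.1 ∈ box d (n + 1) ∧ e.1.1 + Pi.single e.1.2 1 ∈ box d (n + 1))) := by
    rw [Finset.disjoint_filter]
    intro e _ h1 h2
    exact h1.1 h2.1
  rw [hcompl, Finset.prod_union hdisj]
  congr 1
  · -- outer edges: both end-points off `box d (n+1) ⊇ box d n`, factor `v_β(0)`
    refine (Finset.prod_congr rfl fun e he => ?_).trans (Finset.prod_const _)
    obtain ⟨h1, h2⟩ := (Finset.mem_filter.1 he).2
    rw [dirichletExtend_of_not_mem _ (fun h => h2 (box_mono d (Nat.le_succ n) h)),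
      dirichletExtend_of_not_mem _ (fun h => h1 (box_mono d (Nat.le_succ n) h)), sub_zero]
  · -- inner edges: the smaller cube's weight
    have key := prod_filter_inner_eq (n := n) (fun q => villainKernel β
      (dirichletExtend n (fun y' => a (layerEquiv n y')) (q.1 + Pi.single q.2 1) -
        dirichletExtend n (fun y' => a (layerEquiv n y')) q.1))
    beta_reduce at key
    rw [dirichletVillainWeight_eq_prod]
    simp only [gradR_apply]
    convert key using 1


/-- **Change of variables** from the inner block of `box d (n+1)` to the cube `box d n`
(`MeasurableEquiv.piCongrLeft` along `layerEquiv`, volume preserving). [folklore] -/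
theorem setIntegral_angleCube_comp_layerEquiv (H : (SIdx d n → ℝ) → ℝ) :
    ∫ a in angleCube {v : SIdx d (n + 1) // ¬((v : Site d) ∉ box d n)}, H (fun y => a (layerEquiv n y)) =
      ∫ θ in angleCube (SIdx d n), H θ := by
  set f := MeasurableEquiv.piCongrLeft (fun _ : {v : SIdx d (n + 1) // ¬((v : Site d) ∉ box d n)} => ℝ) (layerEquiv n) with hf
  have hmp : MeasurePreserving f volume volume := volume_measurePreserving_piCongrLeft _ _
  have hpre : f ⁻¹' angleCube {v : SIdx d (n + 1) // ¬((v : Site d) ∉ box d n)} = angleCube (SIdx d n) := by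
    rw [hf, MeasurableEquiv.coe_piCongrLeft, angleCube, Equiv.piCongrLeft_preimage_univ_pi]
    rfl
  have key := hmp.setIntegral_preimage_emb f.measurableEmbedding
    (fun a => H (fun y => a (layerEquiv n y))) (angleCube _)
  rw [hpre] at key
  rw [← key]
  refine setIntegral_congr_fun measurableSet_angleCube fun θ _ => ?_
  congr 1

/-! ### Monotonicity in the volume and the thermodynamic limit -/

/-- **The zero-boundary-condition two-point function is non-increasing in the cube** (`d ≥ 1`,
`β > 0`, all `x`): `⟨S_0·S_x⟩_{□_{n+1},β,0} ≤ ⟨S_0·S_x⟩_{□_n,β,0}`. Proof: write the model of the cube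
`box d (n+2)` as a pinned Villain model (`prod_villainKernel_toOpt_eq_weight`); raising the
stiffness of its boundary edges from `β` to `K` can only increase the two-point function (Ginibre,
`pinnedVillainTwoPoint_mono`); as `K → ∞` the outer layer of the interior gets pinned to `0`
(`tendsto_setIntegral_mul_prod_villainKernel_pow_div_of_pinned` with the factorisation
`prod_villainKernel_raised_eq`), and the pinned model is the model of the cube `box d (n+1)`
(`prod_compl_bdryEdges_symm_zero`, `setIntegral_angleCube_comp_layerEquiv`). This is the
monotonicity "in the volume of the system" behind the existence of the thermodynamic limit
(Dario–Wu 2020 p. 4: "a consequence of correlation inequalities [Gi, BFL, MMP]").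
[cite: DarioWu2020, Ch. 1 §1 (PDF p. 4)] -/
theorem dirichletVillainTwoPoint_succ_le (hd : 0 < d) {β : ℝ} (hβ : 0 < β) (n : ℕ) (x : Site d) :
    dirichletVillainTwoPoint β (n + 1) x ≤ dirichletVillainTwoPoint β n x := by
  -- ## Step 1: the model of the larger cube as a pinned model with constant stiffness
  have h1 : dirichletVillainTwoPoint β (n + 1) x =
      (∫ θ in angleCube (SIdx d (n + 1)), Real.cos ((toOpt (n + 1) 0).elim (0 : ℝ) θ - (toOpt (n + 1) x).elim 0 θ) *
          ∏ e : EIdx d (n + 1), villainKernel ((fun _ : EIdx d (n + 1) => β) e) ((toOpt (n + 1) (e.1.1 + Pi.single e.1.2 1)).elim (0 : ℝ) θ - (toOpt (n + 1) e.1.1).elim 0 θ)) /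
        ∫ θ in angleCube (SIdx d (n + 1)), ∏ e : EIdx d (n + 1), villainKernel ((fun _ : EIdx d (n + 1) => β) e) ((toOpt (n + 1) (e.1.1 + Pi.single e.1.2 1)).elim (0 : ℝ) θ - (toOpt (n + 1) e.1.1).elim 0 θ) := by
    simp only [prod_villainKernel_toOpt_eq_weight, cos_toOpt_elim]
    rfl
  -- ## Step 2: Ginibre — raising the boundary stiffness to `K ≥ β` increases the two-point function
  have h2 : ∀ K : ℝ, β ≤ K → dirichletVillainTwoPoint β (n + 1) x ≤
      (∫ θ in angleCube (SIdx d (n + 1)), Real.cos ((toOpt (n + 1) 0).elim (0 : ℝ) θ - (toOpt (n + 1) x).elim 0 θ) *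
          ∏ e : EIdx d (n + 1), villainKernel (if e ∈ bdryEdges (n + 1) then K else β) ((toOpt (n + 1) (e.1.1 + Pi.single e.1.2 1)).elim (0 : ℝ) θ - (toOpt (n + 1) e.1.1).elim 0 θ)) /
        ∫ θ in angleCube (SIdx d (n + 1)), ∏ e : EIdx d (n + 1),
          villainKernel (if e ∈ bdryEdges (n + 1) then K else β) ((toOpt (n + 1) (e.1.1 + Pi.single e.1.2 1)).elim (0 : ℝ) θ - (toOpt (n + 1) e.1.1).elim 0 θ) := by
    intro K hK
    rw [h1]
    exact pinnedVillainTwoPoint_mono (V := SIdx d (n + 1)) (ι := EIdx d (n + 1))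
      (fun e => toOpt (n + 1) e.1.1) (fun e => toOpt (n + 1) (e.1.1 + Pi.single e.1.2 1))
      (κ := fun _ => β) (κ' := fun e => if e ∈ bdryEdges (n + 1) then K else β)
      (fun _ => hβ) (fun e => by
        show β ≤ (if e ∈ bdryEdges (n + 1) then K else β)
        split_ifs
        · exact hK
        · exact le_rfl) (toOpt (n + 1) 0) (toOpt (n + 1) x)
  -- ## Step 3: the pinning limit `K → ∞` gives the model of the smaller cube
  -- the complementary weight `A` and its properties
  obtain ⟨A, hA⟩ : ∃ A : (SIdx d (n + 1) → ℝ) → ℝ, ∀ θ, A θ =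
      ∏ e ∈ (bdryEdges (n + 1))ᶜ, villainKernel β ((toOpt (n + 1) (e.1.1 + Pi.single e.1.2 1)).elim (0 : ℝ) θ - (toOpt (n + 1) e.1.1).elim 0 θ) := ⟨_, fun _ => rfl⟩
  have hAc : Continuous A := by
    rw [show A = fun θ => ∏ e ∈ (bdryEdges (n + 1))ᶜ, villainKernel β ((toOpt (n + 1) (e.1.1 + Pi.single e.1.2 1)).elim (0 : ℝ) θ - (toOpt (n + 1) e.1.1).elim 0 θ) from funext hA]
    exact continuous_finsetProd _ fun e _ => (continuous_villainKernel hβ).comp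
      ((continuous_option_elim _).sub (continuous_option_elim _))
  have hApos : ∀ θ, 0 < A θ := fun θ => by
    rw [hA]; exact Finset.prod_pos fun e _ => villainKernel_pos hβ _
  obtain ⟨M, hM⟩ := exists_villainKernel_le hβ
  have hAle : ∀ θ, A θ ≤ ∏ _e ∈ (bdryEdges (n + 1))ᶜ, max M 1 := fun θ => by
    rw [hA]
    exact Finset.prod_le_prod (fun e _ => (villainKernel_pos hβ _).le) fun e _ => (hM _).trans (le_max_left _ _)
  have hAabs : ∀ θ, |A θ| ≤ ∏ _e ∈ (bdryEdges (n + 1))ᶜ, max M 1 := fun θ => by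
    rw [abs_of_pos (hApos θ)]; exact hAle θ
  have hOc : Continuous fun θ : SIdx d (n + 1) → ℝ => Real.cos ((toOpt (n + 1) 0).elim (0 : ℝ) θ - (toOpt (n + 1) x).elim 0 θ) :=
    Real.continuous_cos.comp ((continuous_option_elim _).sub (continuous_option_elim _))
  have hOAabs : ∀ θ : SIdx d (n + 1) → ℝ, |Real.cos ((toOpt (n + 1) 0).elim (0 : ℝ) θ - (toOpt (n + 1) x).elim 0 θ) * A θ| ≤ ∏ _e ∈ (bdryEdges (n + 1))ᶜ, max M 1 :=
    fun θ => by
    rw [abs_mul, abs_of_pos (hApos θ)]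
    exact (mul_le_of_le_one_left (hApos θ).le (Real.abs_cos_le_one _)).trans (hAle θ)
  -- the factorised form of the integrands
  have hfac : ∀ (K : ℝ) (θ : SIdx d (n + 1) → ℝ),
      ∏ e : EIdx d (n + 1), villainKernel (if e ∈ bdryEdges (n + 1) then K else β) ((toOpt (n + 1) (e.1.1 + Pi.single e.1.2 1)).elim (0 : ℝ) θ - (toOpt (n + 1) e.1.1).elim 0 θ) =
        A θ * ∏ u : {a : SIdx d (n + 1) // (a : Site d) ∉ box d n},
          villainKernel K (θ u) ^ pinMult (n + 1) u.1 := fun K θ => by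
    rw [prod_villainKernel_raised_eq, hA]
  -- the pinned (limit) integrands are those of the smaller cube, after the change of variables
  have hApin : ∀ a : {v : SIdx d (n + 1) // ¬((v : Site d) ∉ box d n)} → ℝ, A ((MeasurableEquiv.piEquivPiSubtypeProd (fun _ : SIdx d (n + 1) => ℝ) (fun a : SIdx d (n + 1) => (a : Site d) ∉ box d n)).symm (0, a)) =
      villainKernel β 0 ^ #((Finset.univ : Finset (EIdx d (n + 1))).filter
          (fun e => e.1.1 ∉ box d (n + 1) ∧ e.1.1 + Pi.single e.1.2 1 ∉ box d (n + 1))) *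
        dirichletVillainWeight β n (fun y' => a (layerEquiv n y')) := fun a => by
    rw [hA]
    exact prod_compl_bdryEdges_symm_zero β a
  set c : ℝ := villainKernel β 0 ^ #((Finset.univ : Finset (EIdx d (n + 1))).filter
      (fun e => e.1.1 ∉ box d (n + 1) ∧ e.1.1 + Pi.single e.1.2 1 ∉ box d (n + 1))) with hc
  have hc0 : 0 < c := pow_pos (villainKernel_pos hβ 0) _
  have hden : ∫ a in angleCube {v : SIdx d (n + 1) // ¬((v : Site d) ∉ box d n)}, A ((MeasurableEquiv.piEquivPiSubtypeProd (fun _ : SIdx d (n + 1) => ℝ) (fun a : SIdx d (n + 1) => (a : Site d) ∉ box d n)).symm (0, a)) =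
      c * ∫ θ in angleCube (SIdx d n), dirichletVillainWeight β n θ := by
    simp_rw [hApin]
    rw [integral_const_mul, setIntegral_angleCube_comp_layerEquiv (dirichletVillainWeight β n)]
  have hnum : ∫ a in angleCube {v : SIdx d (n + 1) // ¬((v : Site d) ∉ box d n)},
      (fun θ : SIdx d (n + 1) → ℝ => Real.cos ((toOpt (n + 1) 0).elim (0 : ℝ) θ - (toOpt (n + 1) x).elim 0 θ) * A θ) ((MeasurableEquiv.piEquivPiSubtypeProd (fun _ : SIdx d (n + 1) => ℝ) (fun a : SIdx d (n + 1) => (a : Site d) ∉ box d n)).symm (0, a)) =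
      c * ∫ θ in angleCube (SIdx d n),
        Real.cos (dirichletExtend n θ 0 - dirichletExtend n θ x) * dirichletVillainWeight β n θ := by
    simp only [toOpt_elim_symm_zero, hApin]
    rw [← setIntegral_angleCube_comp_layerEquiv (n := n)
      (fun θ => Real.cos (dirichletExtend n θ 0 - dirichletExtend n θ x) * dirichletVillainWeight β n θ),
      ← integral_const_mul]
    refine integral_congr_ae (Filter.Eventually.of_forall fun a => ?_)
    simp only
    ring
  have hZpos : 0 < ∫ θ in angleCube (SIdx d n), dirichletVillainWeight β n θ := setIntegral_weight_pos hd hβ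
  have hpos : 0 < ∫ a in angleCube {v : SIdx d (n + 1) // ¬((v : Site d) ∉ box d n)}, A ((MeasurableEquiv.piEquivPiSubtypeProd (fun _ : SIdx d (n + 1) => ℝ) (fun a : SIdx d (n + 1) => (a : Site d) ∉ box d n)).symm (0, a)) := by
    rw [hden]; exact mul_pos hc0 hZpos
  -- the pinning limit
  have hlim := tendsto_setIntegral_mul_prod_villainKernel_pow_div_of_pinned
    (fun a : SIdx d (n + 1) => (a : Site d) ∉ box d n) (fun θ : SIdx d (n + 1) → ℝ => Real.cos ((toOpt (n + 1) 0).elim (0 : ℝ) θ - (toOpt (n + 1) x).elim 0 θ) * A θ) A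
    (hOc.mul hAc) hAc hOAabs hAabs (fun u => pinMult (n + 1) u.1) (fun u => one_le_pinMult u.2) hpos
  rw [hnum, hden, mul_div_mul_left _ _ hc0.ne'] at hlim
  -- ## Step 4: conclusion
  have hlim' : Tendsto (fun K : ℝ =>
      (∫ θ in angleCube (SIdx d (n + 1)), Real.cos ((toOpt (n + 1) 0).elim (0 : ℝ) θ - (toOpt (n + 1) x).elim 0 θ) *
          ∏ e : EIdx d (n + 1), villainKernel (if e ∈ bdryEdges (n + 1) then K else β) ((toOpt (n + 1) (e.1.1 + Pi.single e.1.2 1)).elim (0 : ℝ) θ - (toOpt (n + 1) e.1.1).elim 0 θ)) /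
        ∫ θ in angleCube (SIdx d (n + 1)), ∏ e : EIdx d (n + 1),
          villainKernel (if e ∈ bdryEdges (n + 1) then K else β) ((toOpt (n + 1) (e.1.1 + Pi.single e.1.2 1)).elim (0 : ℝ) θ - (toOpt (n + 1) e.1.1).elim 0 θ))
      atTop (𝓝 (dirichletVillainTwoPoint β n x)) := by
    rw [dirichletVillainTwoPoint]
    refine hlim.congr' (Filter.Eventually.of_forall fun K => ?_)
    simp only [hfac, mul_assoc]
  exact ge_of_tendsto hlim' ((eventually_ge_atTop β).mono fun K hK => h2 K hK)

end DirichletVillain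

open DirichletVillain

variable {d : ℕ}

/-- **`n ↦ ⟨S_0·S_x⟩_{□_n,β,0}` is non-increasing** (`d ≥ 1`, `β > 0`). [cite: DarioWu2020, Ch. 1 §1 (PDF p. 4)] -/
theorem antitone_dirichletVillainTwoPoint (hd : 0 < d) {β : ℝ} (hβ : 0 < β) (x : Site d) :
    Antitone fun n : ℕ => dirichletVillainTwoPoint β n x :=
  antitone_nat_of_succ_le fun n => dirichletVillainTwoPoint_succ_le hd hβ n x

/-- **The thermodynamic limit of the zero-boundary-condition Villain two-point function exists**
(`d ≥ 1`, `β > 0`, every `x ∈ ℤ^d`): `⟨S_0·S_x⟩_{□_n,β,0} → inf_n ⟨S_0·S_x⟩_{□_n,β,0}` as `n → ∞`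
(non-increasing by Ginibre's inequality and bounded below by `-1`) — the first clause of the
printed Proposition ("the thermodynamic limit of the measures (1.1) exists as `□ → ℤ^d` … a
consequence of correlation inequalities [Gi, BFL, MMP]", for the two-point function).
[cite: DarioWu2020, Ch. 1 §1 (PDF p. 4) and Proposition 1.1] -/
theorem tendsto_dirichletVillainTwoPoint_ciInf (hd : 0 < d) {β : ℝ} (hβ : 0 < β) (x : Site d) :
    Tendsto (fun n : ℕ => dirichletVillainTwoPoint β n x) atTop
      (𝓝 (⨅ n : ℕ, dirichletVillainTwoPoint β n x)) :=
  tendsto_atTop_ciInf (antitone_dirichletVillainTwoPoint hd hβ x)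
    ⟨-1, by
      rintro _ ⟨n, rfl⟩
      exact (abs_le.1 (abs_dirichletVillainTwoPoint_le_one hd hβ n x)).1⟩

/-- **Two of the four printed clauses of Dario–Wu 2020, Prop. 1.1 (after Fröhlich–Spencer 1982),
proved, in the transcription of `FrohlichSpencerVillainSpinWaveBound`**: for `d ≥ 3`, every `β > 0`
and every `x`, the zero-boundary-condition cube two-point functions `dirichletVillainTwoPoint β n x`
converge to a limit `G` (thermodynamic limit), and
`G ≤ exp(−(latticeGreen 0 − latticeGreen x)/(2β))` (the spin-wave upper bound
`⟨S_0·S_x⟩ ≤ exp((δ_0 − δ_x, −(1/2β)Δ⁻¹(δ_0 − δ_x)))`); also `|G| ≤ 1`. NOT proved here (and the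
reason the fact is not discharged): the lower bound with the `o(1/β)` correction and the clustering
`c₀ + O(|x|^{2−d})`, which are Fröhlich–Spencer's renormalisation-group estimates on the dual
Coulomb gas. [cite: DarioWu2020, Proposition 1.1 (PDF pp. 4–5)] -/
theorem exists_tendsto_dirichletVillainTwoPoint_le_exp (hd : 3 ≤ d) {β : ℝ} (hβ : 0 < β) (x : Site d) :
    ∃ G : ℝ, Tendsto (fun n : ℕ => dirichletVillainTwoPoint β n x) atTop (𝓝 G) ∧
      G ≤ Real.exp (-(latticeGreen (0 : Site d) - latticeGreen x) / (2 * β)) ∧ |G| ≤ 1 := by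
  have hd1 : 0 < d := by omega
  have hG := tendsto_dirichletVillainTwoPoint_ciInf hd1 hβ x
  refine ⟨_, hG, le_exp_of_tendsto_dirichletVillainTwoPoint hd hβ x hG, abs_le.2 ⟨?_, ?_⟩⟩
  · exact ge_of_tendsto' hG fun n => (abs_le.1 (abs_dirichletVillainTwoPoint_le_one hd1 hβ n x)).1
  · exact le_of_tendsto' hG fun n => (abs_le.1 (abs_dirichletVillainTwoPoint_le_one hd1 hβ n x)).2

end Literature.Probability.LatticeModels
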